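import Literature.NumberTheory.GaloisRepresentations.LocalTatePairing
import Literature.NumberTheory.GaloisRepresentations.ContinuousCupProductCompat
import HarnessLib

/-!
# Poitou–Tate duality: the sum of the local Tate pairings vanishes on global classes

Let `K` be a number field, `n ≥ 1`, `M` a finite discrete `Γ_K`-module killed by `n` and
`M^D = M^∨(1) = Hom(M, μₙ)` its Cartier (Tate) dual (`DiscreteGaloisModule.tateDual`, file
`Literature/NumberTheory/GaloisRepresentations/LocalGlobalCohomology.lean`).  At every place `v`
of `K` there is the **local Tate pairing**

  `⟨·, ·⟩_v : H¹(K_v, M) × H¹(K_v, M^D) → H²(K_v, μₙ) → ℤ/n`,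
  `⟨a, b⟩_v = inv_v (a ∪ b)`,

cup product (`DiscreteGaloisModule.localTatePairing`, file `…/LocalTatePairing.lean`) followed by
the invariant map `inv_v : H²(K_v, μₙ) = Br(K_v)[n] → (1/n)ℤ/ℤ = ℤ/n` of local class field
theory.  The middle of the nine-term **Poitou–Tate exact sequence**

  `H¹(G_S, M) —β¹→ P¹_S(K, M) —γ¹→ H¹(G_S, M^D)^*`

(Milne, *Arithmetic Duality Theorems*, I Thm. 4.10; Harari, *Galois Cohomology and Class Field
Theory*, Thm. 17.13; Neukirch–Schmidt–Wingberg, *Cohomology of Number Fields*, VIII §6; due to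
Tate 1962 and Poitou 1967), where `γ¹` is the dual of `β¹` for `M^D` through the local dualities
`P¹_S(K, M) ≅ P¹_S(K, M^D)^*` given by the `⟨·, ·⟩_v` (Milne I Cor. 2.3, Thm. 2.6, Thm. 2.13;
Harari Prop. 17.11), contains in particular the statement `γ¹ ∘ β¹ = 0` (Milne I Thm. 4.10(b):
`Im β¹ = Ker γ¹`), i.e.

  `∑_v ⟨loc_v x, loc_v y⟩_v = 0`  for all `x ∈ H¹(K, M)`, `y ∈ H¹(K, M^D)`       (PT)

(with `S` = all places: the sum is finite, almost all terms being pairings of unramified classes;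
for a set `S ∋` the archimedean places and those dividing `n`, and `x`, `y` unramified outside `S`,
the terms outside `S` vanish by Milne I Thm. 2.6 and (PT) reads `∑_{v ∈ S} ⟨x_v, y_v⟩_v = 0` for
`x ∈ H¹(G_S, M)`, `y ∈ H¹(G_S, M^D)`).  (PT) is "`inv(x ∪ y) = ∑_v inv_v` of a global Brauer
class is zero": the reciprocity law of the Brauer group (Albert–Brauer–Hasse–Noether exact sequence
`0 → Br K → ⊕_v Br K_v —∑ inv_v→ ℚ/ℤ → 0`, Harari Thm. 14.11) applied to `x ∪ y ∈ H²(K, μₙ)`,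
since localisation commutes with cup products.

## What is here

The tree has the cup-product pairing `localTatePairing ρ n v` into `H²(K_v, μₙ)` and the shape
`localTatePairingZMod ρ n v inv : (a, b) ↦ inv (a ∪ b)` for an additive `inv : H²(K_v, μₙ) → ℤ/n`
**given as a parameter**: the invariant maps of local class field theory are not constructed in
the tree (no Brauer groups of local fields yet).  Accordingly this file

* introduces the data of a **family of local invariant maps** `inv = (inv_v)_v`,
  `LocalInvariants K n := ∀ v : Place K, H²(K_v, μₙ) →+ ℤ/n`, and the **local term**
  `inv.localTerm ρ v x y = inv_v (loc_v x ∪ loc_v y) = ⟨x_v, y_v⟩_v` of a pair of global classes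
  (`LocalInvariants.localTerm`, bi-additive by construction; `localTerm_apply`,
  `localTerm_eq_apply_localization_cupProduct`);
* PROVES that localisation commutes with the cup product,
  `loc_v (x ∪ y) = loc_v x ∪_v loc_v y` (`localization_cupProduct`, from the tree's
  `ContPairing.cupProduct_res`);
* states, as `Prop`-valued predicates **on a family** `inv` (definitions with bodies, not facts):
  the Poitou–Tate vanishing (PT) `LocalInvariants.SumLocalTermEqZero` (for every finite `n`-torsion
  `M`, all `x`, `y`, and every finite set of places `S` outside which the local terms vanish,
  `∑_{v ∈ S} ⟨x_v, y_v⟩_v = 0`), the Brauer reciprocity law on `H²(K, μₙ)`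
  `LocalInvariants.SumInvLocalizationEqZero`, and local Tate duality for the family at the finite
  places `LocalInvariants.IsPerfect` (`inv_v` bijective and `inv_v (· ∪ ·)` perfect);
* PROVES (PT) for a family from its Brauer reciprocity law
  (`sumLocalTermEqZero_of_sumInvLocalizationEqZero`) and the "receptacle" form of (PT), the local
  term at one place is minus the sum of the others (`SumLocalTermEqZero.localTerm_eq_neg_sum`);
* vendors ONE named fact (D-0014), `poitouTate_sum_localTatePairing_eq_zero K`: for every
  `n ≥ 1` there is a family of local invariant maps which is a local Tate duality at the finite
  places and satisfies (PT) — in the sources, the family of invariant maps of class field theory;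
  and PROVES that it implies the tree's existence form of local Tate duality
  `exists_perfectPairing_galoisCohomology_tateDual` (`…_of_poitouTate`).

## Design notes

* Why an existential over families.  The printed theorem is about THE invariant maps `inv_v`;
  the tree cannot name them, so the fact asserts the existence of a family with the printed
  properties (the same device as the tree's `exists_perfectPairing_galoisCohomology_tateDual`).
  The conjunct `IsPerfect` is what makes the existential contentful (the zero family satisfies
  (PT) trivially); consumers take `inv` from the fact and argue with `inv.localTerm`.
* Form of (PT).  Milne's `P¹_S` is a restricted product and `γ¹` a finite sum; we phrase
  "`∑_v ⟨x_v, y_v⟩_v = 0`" as: for every finite `S : Finset (Place K)` with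
  `⟨x_v, y_v⟩_v = 0` for `v ∉ S`, `∑_{v ∈ S} ⟨x_v, y_v⟩_v = 0`.  The finiteness of the support
  (Milne I Lemma 4.8 with Thm. 2.6) is a separate statement and is NOT asserted here; nor is the
  vanishing of `⟨x_v, y_v⟩_v` for classes unramified at `v ∤ n` (Milne I Thm. 2.6), which turns
  (PT) into the `G_S`-form displayed above — both would be further named facts (D-0026).
* Archimedean places need no Tate modification here: only `H¹` and `H²` of `Γ_{K_v}` occur
  (`Ĥʳ = Hʳ` for `r ≥ 1`); at a complex place all terms vanish.
* `M` is assumed killed by `n`, so that `Hom(M, μₙ)` is the Cartier dual `Hom(M, μ)` of the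
  sources; `μₙ = μₙ(K̄)` restricted to `Γ_{K_v}` along the tree's `absGaloisRestrict` stands for
  `μₙ(K̄_v)`.

## Not here

The rest of the Poitou–Tate sequence (`Ker γ¹ ⊆ Im β¹`, the `H⁰`/`H²` rows, finiteness and
duality of `Ш¹_S` and `Ш²_S`, Milne I Thm. 4.10(a),(c)), the Brauer group of a local field and
the construction of `inv_v`, Milne I Thm. 2.6 (unramified classes annihilate each other).

## References

* J. S. Milne, *Arithmetic Duality Theorems*, 2nd ed. (2006), Ch. I: Cor. 2.3, Thm. 2.6,
  Thm. 2.13, Lemma 4.8, Thm. 4.10 (pp. 56–57), Cor. 4.16, Thm. 4.20 — read (author's PDF).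
  [MilneADT2006]
* D. Harari, *Galois Cohomology and Class Field Theory* (EDP/Springer, 2017/2020): Prop. 8.13
  (`H²(K, μₙ) ≅ ℤ/n` for a `p`-adic field), Thm. 10.9 (Tate local duality), Thm. 14.11
  (Brauer–Hasse–Noether), Rem. 14.12, Prop. 17.11, Thm. 17.13 (Poitou–Tate) — read (held).
  [Harari2020]
* J. Neukirch, A. Schmidt, K. Wingberg, *Cohomology of Number Fields*, 2nd ed. (2008), VIII §6
  (Poitou–Tate duality) — not re-read here. [NeukirchSchmidtWingberg2008]
* J. Tate, *Duality theorems in Galois cohomology over number fields*, Proc. ICM Stockholm 1962,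
  288–295 (announcement). [Tate1963DualityICM]
-/

noncomputable section

open Function NumberField IsDedekindDomain
open scoped NumberField

universe u

namespace Literature.NumberTheory.GaloisCohomology

open Literature.NumberTheory.GaloisRepresentations
open Literature.NumberTheory.GaloisRepresentations.DiscreteGaloisModule (mu MuCarrier
  localTatePairing localTatePairingZMod localTatePairingZMod_apply tateDualPairing)

-- As in the tree's `LocalTatePairing.lean`: cup products need `LocallyCompactSpace Γ`; the theorem
-- `absoluteGaloisGroup_compactSpace` (every field) is the only source of it for `Γ_{K_v}`,
-- `K_v = Place.Completion v` carrying no `CharZero` instance.  Local to this file, no override.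
attribute [local instance] absoluteGaloisGroup_compactSpace

variable {K : Type u} [Field K] [NumberField K]

/-! ### Families of local invariant maps and the local terms `⟨x_v, y_v⟩_v` -/

/-- A **family of local invariant maps** at level `n` for the number field `K`: for every place
`v` an additive map `inv_v : H²(K_v, μₙ) →+ ℤ/n` on the continuous cohomology of `Γ_{K_v}` with
coefficients `μₙ(K̄)|_{Γ_{K_v}}` (the target of the tree's `localTatePairing ρ n v`).  The intended
inhabitant is the family of invariant isomorphisms `inv_v : H²(K_v, μₙ) = Br(K_v)[n] ⥲ (1/n)ℤ/ℤ`
of local class field theory (finite `v`; at a real place `Br(ℝ)[n] ↪ (1/n)ℤ/ℤ`, at a complex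
place `0`), which the tree does not construct; statements are therefore made about a family and
the class-field-theoretic family is asserted to exist (`poitouTate_sum_localTatePairing_eq_zero`).
Ref: Harari, *Galois Cohomology and Class Field Theory*, Thm. 8.9, Prop. 8.13, Thm. 14.11;
Milne, *Arithmetic Duality Theorems* (2006), I §1 (`inv_v`), I §4. [folklore] -/
abbrev LocalInvariants (K : Type u) [Field K] [NumberField K] (n : ℕ) : Type u :=
  ∀ v : Place K, galoisCohomology ((mu K n).toLocal v) 2 →+ ZMod n

namespace LocalInvariants

section LocalTerm

variable {n : ℕ} {M : Type u} [AddCommGroup M] [TopologicalSpace M] [DiscreteTopology M]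
  [Finite M]

/-- **The local term `⟨x_v, y_v⟩_v = inv_v (loc_v x ∪ loc_v y) ∈ ℤ/n`** at the place `v` of a
pair of global classes `x ∈ H¹(K, M)`, `y ∈ H¹(K, M^D)` for a family of local invariant maps
`inv`: localisation (`galoisCohomology.localization`), the local Tate pairing
(`DiscreteGaloisModule.localTatePairing`, cup product for the evaluation `M × M^D → μₙ`) and
`inv_v` (`DiscreteGaloisModule.localTatePairingZMod`); as a bi-additive map
`H¹(K, M) →+ H¹(K, M^D) →+ ℤ/n`.  These are the summands of Milne's
`γ¹(β¹ x)(y) = ∑_v ⟨x_v, y_v⟩_v`.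
Ref: Milne, *Arithmetic Duality Theorems* (2006), I §4, the maps `β¹`, `γ¹` before Thm. 4.10;
Harari, *Galois Cohomology and Class Field Theory*, Prop. 17.11.
[cite: MilneADT2006, Ch. I §4, Thm. 4.10] -/
def localTerm (inv : LocalInvariants K n) (ρ : DiscreteGaloisModule K M) (v : Place K) :
    galoisCohomology ρ 1 →+ galoisCohomology (ρ.tateDual n) 1 →+ ZMod n :=
  ((localTatePairingZMod ρ n v (inv v)).comp (galoisCohomology.localization ρ v 1)).compl₂
    (galoisCohomology.localization (ρ.tateDual n) v 1)

/-- Unfolding the local term: `⟨x_v, y_v⟩_v = inv_v (loc_v x ∪ loc_v y)`. [folklore] -/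
@[simp] theorem localTerm_apply (inv : LocalInvariants K n) (ρ : DiscreteGaloisModule K M)
    (v : Place K) (x : galoisCohomology ρ 1) (y : galoisCohomology (ρ.tateDual n) 1) :
    inv.localTerm ρ v x y =
      inv v (localTatePairing ρ n v (galoisCohomology.localization ρ v 1 x)
        (galoisCohomology.localization (ρ.tateDual n) v 1 y)) := rfl

/-- **Localisation commutes with the cup product**: for global classes `x ∈ H¹(K, M)`,
`y ∈ H¹(K, M^D)`, the localisation at `v` of the global cup product `x ∪ y ∈ H²(K, μₙ)` (for the
evaluation pairing `M × M^D → μₙ`, `DiscreteGaloisModule.tateDualPairing`) is the local Tate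
pairing of the localisations, `loc_v (x ∪ y) = loc_v x ∪ loc_v y` (the tree's
`ContPairing.cupProduct_res` along `Γ_{K_v} → Γ_K`; the two sides agree definitionally).
Ref: Neukirch–Schmidt–Wingberg, *Cohomology of Number Fields* (2008), I §§4–5 (functoriality of
the cup product, compatibility with `res`); the tree's `ContPairing.cupProduct_res`. [folklore] -/
theorem localization_cupProduct (ρ : DiscreteGaloisModule K M) (n : ℕ) (v : Place K)
    (x : galoisCohomology ρ 1) (y : galoisCohomology (ρ.tateDual n) 1) :
    galoisCohomology.localization (mu K n) v 2 ((tateDualPairing ρ n).cupProduct x y) =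
      localTatePairing ρ n v (galoisCohomology.localization ρ v 1 x)
        (galoisCohomology.localization (ρ.tateDual n) v 1 y) :=
  ContPairing.cupProduct_res (tateDualPairing ρ n) (absGaloisRestrict K (Place.Completion v)) x y

/-- The local term is `inv_v` of the localisation of the global cup product:
`⟨x_v, y_v⟩_v = inv_v (loc_v (x ∪ y))`. [folklore] -/
theorem localTerm_eq_apply_localization_cupProduct (inv : LocalInvariants K n)
    (ρ : DiscreteGaloisModule K M) (v : Place K) (x : galoisCohomology ρ 1)
    (y : galoisCohomology (ρ.tateDual n) 1) :
    inv.localTerm ρ v x y =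
      inv v (galoisCohomology.localization (mu K n) v 2
        ((tateDualPairing ρ n).cupProduct x y)) := by
  rw [localTerm_apply, localization_cupProduct]

end LocalTerm

/-! ### Properties of a family: reciprocity, the Poitou–Tate vanishing, local duality -/

section Predicates

variable {n : ℕ}

/-- **The reciprocity law of the Brauer group for the family `inv`, on `H²(K, μₙ)`**: for every
global class `c ∈ H²(K, μₙ)` and every finite set of places `S` outside which the `inv_v (loc_v c)`
vanish, `∑_{v ∈ S} inv_v (loc_v c) = 0`.  For the invariant maps of class field theory this is the
complex property `(∑_v inv_v) ∘ (Br K → ⊕_v Br K_v) = 0` of the Albert–Brauer–Hasse–Noether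
sequence `0 → Br K → ⊕_v Br K_v → ℚ/ℤ → 0` restricted to `H²(K, μₙ) = Br(K)[n]` (Hilbert 90).
A `Prop`-valued predicate on the family, not a named fact.
Ref: Harari, *Galois Cohomology and Class Field Theory*, Thm. 14.11 and Rem. 14.12;
Milne, *Arithmetic Duality Theorems* (2006), I §4 and Appendix A. [cite: Harari2020, Thm. 14.11] -/
def SumInvLocalizationEqZero (inv : LocalInvariants K n) : Prop :=
  ∀ (c : galoisCohomology (mu K n) 2) (S : Finset (Place K)),
    (∀ v ∉ S, inv v (galoisCohomology.localization (mu K n) v 2 c) = 0) →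
      ∑ v ∈ S, inv v (galoisCohomology.localization (mu K n) v 2 c) = 0

/-- **The Poitou–Tate vanishing for the family `inv`** ("the sum of the local Tate pairings
vanishes on global classes"): for every finite discrete `Γ_K`-module `M` killed by `n`, all
`x ∈ H¹(K, M)`, `y ∈ H¹(K, M^D)` (`M^D = Hom(M, μₙ)`), and every finite set of places `S` outside
which the local terms vanish,

  `∑_{v ∈ S} ⟨x_v, y_v⟩_v = ∑_{v ∈ S} inv_v (loc_v x ∪ loc_v y) = 0`.

For the invariant maps of class field theory this is Milne, *ADT*, I Thm. 4.10(b) for `r = 1`,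
inclusion `Im β¹ ⊆ Ker γ¹`, with `S` there the set of all places
(`γ¹(β¹ x) = (y ↦ ∑_v ⟨x_v, y_v⟩_v)`, a finite sum in the restricted product `P¹(K, M)`);
equivalently the exactness-as-a-complex at `P¹_S` of the Poitou–Tate sequence (Harari
Thm. 17.13).  For `x ∈ H¹(G_S, M)`, `y ∈ H¹(G_S, M^D)`
and `S ⊇ {v | ∞} ∪ {v | n}` the hypothesis holds by Milne I Thm. 2.6 (unramified classes are
orthogonal), giving the printed `∑_{v ∈ S} ⟨x_v, y_v⟩_v = 0`; that local statement and the
finiteness of the support are not part of this predicate.  A `Prop`-valued predicate on the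
family, not a named fact (see `poitouTate_sum_localTatePairing_eq_zero`).
Ref: Milne, *Arithmetic Duality Theorems* (2006), I Thm. 4.10(b) (p. 57); Harari, *Galois
Cohomology and Class Field Theory*, Thm. 17.13(c). [cite: MilneADT2006, Ch. I, Thm. 4.10(b)] -/
def SumLocalTermEqZero (inv : LocalInvariants K n) : Prop :=
  ∀ ⦃M : Type u⦄ [AddCommGroup M] [TopologicalSpace M] [DiscreteTopology M] [Finite M]
    (ρ : DiscreteGaloisModule K M), (∀ m : M, n • m = 0) →
    ∀ (x : galoisCohomology ρ 1) (y : galoisCohomology (ρ.tateDual n) 1) (S : Finset (Place K)),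
      (∀ v ∉ S, inv.localTerm ρ v x y = 0) → ∑ v ∈ S, inv.localTerm ρ v x y = 0

/-- **Local Tate duality for the family `inv` at the finite places**: for every finite place `v`,
`inv_v : H²(K_v, μₙ) → ℤ/n` is bijective (Harari Prop. 8.13: `H²(K_v, μₙ) = Br(K_v)[n] ≅ ℤ/n`),
and for every finite discrete `Γ_K`-module `M` killed by `n` the pairing
`(a, b) ↦ inv_v (a ∪ b) : H¹(K_v, M) × H¹(K_v, M^D) → ℤ/n` (`localTatePairingZMod`) is perfect,
i.e. both adjoints are bijective (Tate local duality, Milne I Cor. 2.3 / Harari Thm. 10.9, in the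
form of the tree's `exists_perfectPairing_galoisCohomology_tateDual`).  A `Prop`-valued
predicate on the family, not a named fact.
Ref: Milne, *Arithmetic Duality Theorems* (2006), I Cor. 2.3; Harari, *Galois Cohomology and
Class Field Theory*, Prop. 8.13, Thm. 10.9. [cite: MilneADT2006, Ch. I, Cor. 2.3] -/
def IsPerfect (inv : LocalInvariants K n) : Prop :=
  ∀ v : HeightOneSpectrum (𝓞 K),
    Bijective (inv (Sum.inr v)) ∧
    ∀ ⦃M : Type u⦄ [AddCommGroup M] [TopologicalSpace M] [DiscreteTopology M] [Finite M]
      (ρ : DiscreteGaloisModule K M), (∀ m : M, n • m = 0) →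
      Bijective (localTatePairingZMod ρ n (Sum.inr v) (inv (Sum.inr v))) ∧
        Bijective (localTatePairingZMod ρ n (Sum.inr v) (inv (Sum.inr v))).flip

/-- **(PT) from the reciprocity law of the Brauer group.**  If the family `inv` satisfies
`∑_v inv_v (loc_v c) = 0` on global classes `c ∈ H²(K, μₙ)` (`SumInvLocalizationEqZero`), then
the sum of its local Tate pairings vanishes on global classes (`SumLocalTermEqZero`): apply the
hypothesis to `c = x ∪ y`, using `⟨x_v, y_v⟩_v = inv_v (loc_v (x ∪ y))`
(`localTerm_eq_apply_localization_cupProduct`).  This is the proof of `Im β¹ ⊆ Ker γ¹` in the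
sources.  Ref: Milne, *Arithmetic Duality Theorems* (2006), I §4, proof of Thm. 4.10;
Harari, *Galois Cohomology and Class Field Theory*, Rem. 14.12. [folklore] -/
theorem sumLocalTermEqZero_of_sumInvLocalizationEqZero (inv : LocalInvariants K n)
    (h : inv.SumInvLocalizationEqZero) : inv.SumLocalTermEqZero := by
  intro M _ _ _ _ ρ _ x y S hS
  simp only [localTerm_eq_apply_localization_cupProduct] at hS ⊢
  exact h _ S hS

/-- **The local term at one place is minus the sum of the others** ("receptacle" form of (PT)):
if the family satisfies the Poitou–Tate vanishing, `S` is a finite set of places outside which the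
local terms of `(x, y)` vanish and `v₀ ∈ S`, then
`⟨x_{v₀}, y_{v₀}⟩_{v₀} = -∑_{v ∈ S ∖ {v₀}} ⟨x_v, y_v⟩_v`.
Ref: Milne, *Arithmetic Duality Theorems* (2006), I Thm. 4.10(b). [folklore] -/
theorem SumLocalTermEqZero.localTerm_eq_neg_sum [DecidableEq (Place K)] {inv : LocalInvariants K n}
    (h : inv.SumLocalTermEqZero) {M : Type u} [AddCommGroup M] [TopologicalSpace M]
    [DiscreteTopology M] [Finite M] (ρ : DiscreteGaloisModule K M) (hM : ∀ m : M, n • m = 0)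
    (x : galoisCohomology ρ 1) (y : galoisCohomology (ρ.tateDual n) 1) {S : Finset (Place K)}
    (hS : ∀ v ∉ S, inv.localTerm ρ v x y = 0) {v₀ : Place K} (hv₀ : v₀ ∈ S) :
    inv.localTerm ρ v₀ x y = -∑ v ∈ S.erase v₀, inv.localTerm ρ v x y := by
  rw [eq_neg_iff_add_eq_zero, Finset.add_sum_erase S (fun v => inv.localTerm ρ v x y) hv₀]
  exact h ρ hM x y S hS

/-- (PT) with the local terms vanishing outside `S` and at all places of `S` but `v₀` forces the
term at `v₀` to vanish too (no single place can carry a nonzero local term).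
Ref: Milne, *Arithmetic Duality Theorems* (2006), I Thm. 4.10(b). [folklore] -/
theorem SumLocalTermEqZero.localTerm_eq_zero {inv : LocalInvariants K n}
    (h : inv.SumLocalTermEqZero) {M : Type u} [AddCommGroup M] [TopologicalSpace M]
    [DiscreteTopology M] [Finite M] (ρ : DiscreteGaloisModule K M) (hM : ∀ m : M, n • m = 0)
    (x : galoisCohomology ρ 1) (y : galoisCohomology (ρ.tateDual n) 1) (v₀ : Place K)
    (hS : ∀ v ≠ v₀, inv.localTerm ρ v x y = 0) : inv.localTerm ρ v₀ x y = 0 := by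
  have := h ρ hM x y {v₀} fun v hv => hS v (by simpa using hv)
  simpa using this

end Predicates

end LocalInvariants

/-! ### The named fact (D-0014) and its corollaries -/

section Fact

/-- **Poitou–Tate duality, middle of the nine-term sequence, as a complex: the sum of the local
Tate pairings vanishes on global classes** (with Tate local duality for the same pairings).
For a number field `K` and every `n ≥ 1` there is a family of local invariant maps
`inv_v : H²(K_v, μₙ) →+ ℤ/n` (`v` over all places of `K`) such that

* (local Tate duality, finite places; Milne I Cor. 2.3, Harari Prop. 8.13 and Thm. 10.9)
  `inv_v` is bijective and `(a, b) ↦ inv_v (a ∪ b)` is a perfect pairing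
  `H¹(K_v, M) × H¹(K_v, M^D) → ℤ/n` for every finite discrete `Γ_K`-module `M` with `nM = 0`,
  `M^D = Hom(M, μₙ)` (`LocalInvariants.IsPerfect`), and
* (Poitou–Tate; Milne I Thm. 4.10(b), `r = 1`, `Im β¹ ⊆ Ker γ¹`; Harari Thm. 17.13(c)) for every
  such `M`, all `x ∈ H¹(K, M)`, `y ∈ H¹(K, M^D)` and every finite set of places `S` outside which
  the local terms vanish, `∑_{v ∈ S} inv_v (loc_v x ∪ loc_v y) = 0`
  (`LocalInvariants.SumLocalTermEqZero`).

In the sources both hold for THE invariant maps of local class field theory, which the tree does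
not construct; the fact records the existence of such a family, exactly as the tree's
`exists_perfectPairing_galoisCohomology_tateDual` records local duality, which it implies
(`exists_perfectPairing_galoisCohomology_tateDual_of_poitouTate`).  Printed hypotheses kept: `K` a
number field (for function fields `n` must be prime to the characteristic), `M` finite and killed
by `n` (so that `Hom(M, μₙ)` is the Cartier dual), `n ≥ 1`.  What (PT) does not include: the
finiteness of the set of `v` with `⟨x_v, y_v⟩_v ≠ 0` and the orthogonality of unramified classes
(Milne I Thm. 2.6), which give the form `∑_{v ∈ S} ⟨x_v, y_v⟩_v = 0` for `x ∈ H¹(G_S, M)`,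
`y ∈ H¹(G_S, M^D)`, `S ⊇ {v | ∞} ∪ {v | n}`; and the converse inclusion `Ker γ¹ ⊆ Im β¹`.
Ref: J. S. Milne, *Arithmetic Duality Theorems*, 2nd ed. (2006), Ch. I, Thm. 4.10(b) (p. 57),
with Cor. 2.3; D. Harari, *Galois Cohomology and Class Field Theory*, Thm. 17.13, with Prop. 8.13,
Thm. 10.9, Prop. 17.11; J. Neukirch, A. Schmidt, K. Wingberg, *Cohomology of Number Fields*
(2008), VIII §6; J. Tate, Proc. ICM 1962. [cite: MilneADT2006, Ch. I, Thm. 4.10(b)] -/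
def poitouTate_sum_localTatePairing_eq_zero (K : Type u) [Field K] [NumberField K] : Prop :=
  ∀ (n : ℕ) [NeZero n], ∃ inv : LocalInvariants K n, inv.IsPerfect ∧ inv.SumLocalTermEqZero

variable {M : Type u} [AddCommGroup M] [TopologicalSpace M] [DiscreteTopology M]

/-- **Poitou–Tate (as vendored) implies the tree's local Tate duality fact**
`exists_perfectPairing_galoisCohomology_tateDual`: the perfect pairing at the finite place `v` is
`(a, b) ↦ inv_v (a ∪ b)` for the family provided by the fact.
Ref: Milne, *Arithmetic Duality Theorems* (2006), I Cor. 2.3. [folklore] -/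
theorem exists_perfectPairing_galoisCohomology_tateDual_of_poitouTate
    (h : poitouTate_sum_localTatePairing_eq_zero K) :
    exists_perfectPairing_galoisCohomology_tateDual (K := K) (M := M) := by
  intro _ ρ n _ hM v
  obtain ⟨inv, hperf, -⟩ := h n
  exact ⟨localTatePairingZMod ρ n (Sum.inr v) (inv (Sum.inr v)), (hperf v).2 ρ hM⟩

end Fact

end Literature.NumberTheory.GaloisCohomology

end
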